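import Literature.MathematicalPhysics.QuantumFieldTheory.Balaban1983to89.B8SockP5uEWindows

/-!
# `Balaban1983to89.B8SockWindowsSrc` — [Balaban1985RegularSpaces] Thm 4 p. 88 ∕ Prop. 5 p. 94 «there exist positive constants c₁, c₂, c₃» FOR THE SOURCED
# PROPOSITION-5 SOCKETS OF THE THEOREM-8 KNIT: the displayed windows families of this seat's providers `B8SockSP5ProviderSrc.sp5_of_sockLettersRD_src` (`SP5`),
# `B8SockSP5BaseSrc.sp5base_of_sockLettersRD_src` (`SP5base`) and `B8SockSP5uProviderSrc.sp5uE_of_lettersUB_src` (`SP5u`) FROM ONE THRESHOLD EACH —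
# by MONOTONICITY from the un-sourced windows lemmas `B8SockHFPWindows.hfpWindows_of_guard` ∕ `B8SockP5uEWindows.uniqWindows_of_guard` read at an
# ENLARGED constant (`B₈ + γ`, resp. `2B₈ + γ`): the source's half-size `γ(α₀ + α₁)∕2` in the `m_E` slot of `M_c`, `K_c` is absorbed into the `c_{DA}` slot

statement-level skeleton of published theorems with citation tags; proofs where landed; nothing here is a claim about the Yang–Mills mass gap

T. Bałaban, *Spaces of regular gauge field configurations on a lattice and gauge fixing conditions*, Commun. Math. Phys. **99** (1985) 75–102
`[Balaban1985RegularSpaces]` ("B8"): Thm 4 p. 88 («there exists a constant c₁»), Prop. 5 p. 94 («c₂, c₃ depending on d and L only»; «largest possible α₄ …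
independent of α₀ + α₁»), (1.99) p. 93, (1.102)–(1.103) p. 93, (1.106) p. 94, Thm 8 (1.146) p. 101 («Inspecting the proofs … we see they can be modified»).

WHY THIS FILE (cell `pub-ymgap`, HUMAN RULING D-0062; R134 acceleration seat `pub-ymgap-dag-n05-d` (g5)).  The three sourced providers take their scalar
windows as a DISPLAYED family `hwin`; the un-sourced lineage discharges the same families from one threshold (`hfpWindows_of_guard`, `uniqWindows_of_guard`).
With a source `f` of size `|f|₍₋₂₎ ≤ γ(α₀ + α₁)` the only change is the `m_E` slot of the contraction constants, read at `h_E₂ + γ(α₀ + α₁)∕2`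
(`B8Prop5ContractionKLevelSrc`: `M_c`, `K_c` are affine there), and `c_{DA} = 2dL²c⋆₈`.  Since `m_W = (6∕5)c_{DA} + 2m_E + …` and
`K_W = 18c_{DA}ℓ₀ + 10m_Eℓ₀ + …` ((1.99), (1.106)), the half-size moves into the `c_{DA}` slot (`m_W(…, m_E + t∕2, c_{DA}) = m_W(…, m_E, c_{DA} + 5t∕6)`,
`K_W(…, m_E + t∕2, c_{DA}, …) ≤ K_W(…, m_E, c_{DA} + 5t∕6, …)`), and every window is ANTITONE in `c⋆, c_B, c_{DA}, h_E, h_E₂, l_E, l_E₂`; so the sourced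
families follow from the un-sourced lemmas at the constant `B₈ + γ` (existence: with `B₀′ ↦ B₀′B₈∕(B₈ + γ)`, which keeps `α₄ = 8B₀′(5dLB₈)(α₀ + α₁)` and turns
the free-constant condition into `3·(2dL²)·B_G·B_R·(B₈ + γ) ≤ B₀′·B₈`) and `2B₈ + γ` (uniqueness, whose `c_{DA}` slot is `dL²c⋆`).  THIS FILE PROVES
`mWc_src_eq`, `KWc_src_le`, `Mc_src_le`, `Kc_src_le` (the slot bookkeeping), **`hfpWindows_of_guard_src`** (the 29-conjunct family of `SP5`∕`SP5base`:
the 26 of `hfpWindows_of_guard` minus the two b9 thresholds, at the sourced slots, plus `α₄ ≤ 1∕84`, `c⋆₈ ≤ 1∕12`, `α₁ ≤ 1∕4`) and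
**`uniqWindows_of_guard_src`** (the 27-conjunct family of `SP5u` with print's `∃ α₄, c_u, c_P`).

HONEST SCOPE.  Scalar bookkeeping only (real inequalities between the lineage's explicit constants); no configuration, no operator, no estimate of the
paper is touched; thresholds sufficient, not optimal.  Count-neutral; N05 NOT discharged; nothing continuum / ℝ⁴ / OS / mass-gap / Clay.  No `sorry`,
no `def`, no `instance`, no `notation`.  Unit `pub-ymgap-dag-n05-d` (g5), 2026-08-27.
-/

noncomputable section

open NormedSpace

namespace Literature.MathematicalPhysics.QuantumFieldTheory.Balaban1983to89.B8SockWindowsSrc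

open B7Prop2Explicit (C0 c2')
open B7Prop3Flat (c3)
open B7Prop10General (C6 C4G)
open B7Prop9Flat (C5')
open B8Ineq125Concrete (C2p)
open B8Prop5ContractionKLevel (mWc Mc KWc Kc)
open B7ConclGaugeLin (two_le_C6' C4G_pos')
open B8SockHFPWindows (C2p_pos mWc_mono KWc_mono hfpWindows_of_guard)
open B8SockP5uEWindows (uniqWindows_of_guard)

variable {d L : ℕ}

/-! ## §1 The source's half-size moves from the `m_E` slot to the `c_{DA}` slot -/

/-- `m_W(b₁, c_A, m_E + t∕2, c_{DA}) = m_W(b₁, c_A, m_E, c_{DA} + 5t∕6)` (`m_W = (6∕5)c_{DA} + 2m_E + …`). [cite: Balaban1985RegularSpaces, (1.99) p.93] -/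
theorem mWc_src_eq (b₁ cA mE cDA t : ℝ) : mWc d b₁ cA (mE + t / 2) cDA = mWc d b₁ cA mE (cDA + 5 / 6 * t) := by
  unfold mWc; ring

/-- `K_W(b₁, c_A, m_E + t∕2, c_{DA}, K_E, ℓ₀, ℓ₁) ≤ K_W(b₁, c_A, m_E, c_{DA} + 5t∕6, K_E, ℓ₀, ℓ₁)` for `t, ℓ₀ ≥ 0` (`10·(t∕2)ℓ₀ ≤ 18·(5t∕6)ℓ₀`).
[cite: Balaban1985RegularSpaces, (1.106) p.94] -/
theorem KWc_src_le (b₁ cA mE cDA KE ℓ₁ : ℝ) {t ℓ₀ : ℝ} (ht : 0 ≤ t) (hl : 0 ≤ ℓ₀) :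
    KWc d b₁ cA (mE + t / 2) cDA KE ℓ₀ ℓ₁ ≤ KWc d b₁ cA mE (cDA + 5 / 6 * t) KE ℓ₀ ℓ₁ := by
  unfold KWc
  have h := mul_nonneg ht hl
  nlinarith only [h]

/-- **`M_c` with the source in the `m_E` slot is below `M_c` at enlarged scales**: `b₁ ≤ b₁′`, `c_A ≤ c_A′`, `m_E ≤ m_E′`, `c_{DA} + 5t∕6 ≤ c_{DA}′`.
[cite: Balaban1985RegularSpaces, (1.99) p.93, (1.101) p.93] -/
theorem Mc_src_le {BR b₁ b₁' cA cA' mE mE' cDA cDA' t : ℝ} (hBR : 0 ≤ BR) (hb : 0 ≤ b₁) (hbb : b₁ ≤ b₁') (hc : 0 ≤ cA) (hcc : cA ≤ cA')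
    (hm : mE ≤ mE') (hD : cDA + 5 / 6 * t ≤ cDA') : Mc d BR b₁ cA (mE + t / 2) cDA ≤ Mc d BR b₁' cA' mE' cDA' := by
  unfold Mc
  rw [mWc_src_eq]
  have h := mWc_mono (d := d) hb hbb hc hcc hm hD
  have h2 : 2 * mWc d b₁ cA mE (cDA + 5 / 6 * t) ≤ 2 * mWc d b₁' cA' mE' cDA' := by linarith only [h]
  exact mul_le_mul_of_nonneg_left h2 hBR

/-- **`K_c` with the source in the `m_E` slot is below `K_c` at enlarged scales** (all arguments in their non-negative ranges).
[cite: Balaban1985RegularSpaces, (1.106) p.94] -/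
theorem Kc_src_le {BR b₁ b₁' cA cA' mE mE' cDA cDA' KE KE' ℓ ℓ' t : ℝ} (hBR : 0 ≤ BR) (hb : 0 ≤ b₁) (hbb : b₁ ≤ b₁') (hc : 0 ≤ cA) (hcc : cA ≤ cA')
    (hm0 : 0 ≤ mE) (hm : mE ≤ mE') (hD0 : 0 ≤ cDA) (ht : 0 ≤ t) (hD : cDA + 5 / 6 * t ≤ cDA') (hK : KE ≤ KE') (hl0 : 0 ≤ ℓ) (hl : ℓ ≤ ℓ') :
    Kc d BR b₁ cA (mE + t / 2) cDA KE ℓ ℓ ≤ Kc d BR b₁' cA' mE' cDA' KE' ℓ' ℓ' := by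
  unfold Kc
  have hD0' : 0 ≤ cDA + 5 / 6 * t := by positivity
  have h1 : KWc d b₁ cA (mE + t / 2) cDA KE ℓ ℓ ≤ KWc d b₁' cA' mE' cDA' KE' ℓ' ℓ' :=
    (KWc_src_le (d := d) b₁ cA mE cDA KE ℓ ht hl0).trans (KWc_mono (d := d) hb hbb hc hcc hm0 hm hD0' hD hK hl0 hl hl0 hl)
  have h2 : BR * (2 * mWc d b₁ cA (mE + t / 2) cDA) ≤ BR * (2 * mWc d b₁' cA' mE' cDA') := by
    have h := Mc_src_le (d := d) hBR hb hbb hc hcc hm hD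
    unfold Mc at h
    exact h
  have hM0 : 0 ≤ BR * (2 * mWc d b₁' cA' mE' cDA') := by
    have hb' : 0 ≤ b₁' := hb.trans hbb
    have hc' : 0 ≤ cA' := hc.trans hcc
    have hm' : 0 ≤ mE' := hm0.trans hm
    have hD' : 0 ≤ cDA' := hD0'.trans hD
    have : 0 ≤ mWc d b₁' cA' mE' cDA' := by unfold mWc; positivity
    positivity
  have h3 : 10 * ℓ * (BR * (2 * mWc d b₁ cA (mE + t / 2) cDA)) ≤ 10 * ℓ' * (BR * (2 * mWc d b₁' cA' mE' cDA')) := by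
    have a := mul_le_mul_of_nonneg_left h2 (by positivity : (0 : ℝ) ≤ 10 * ℓ)
    have b := mul_le_mul_of_nonneg_right (by linarith only [hl] : 10 * ℓ ≤ 10 * ℓ') hM0
    exact a.trans b
  have h4 : 2 * (KWc d b₁ cA (mE + t / 2) cDA KE ℓ ℓ + 10 * ℓ * (BR * (2 * mWc d b₁ cA (mE + t / 2) cDA))) ≤
      2 * (KWc d b₁' cA' mE' cDA' KE' ℓ' ℓ' + 10 * ℓ' * (BR * (2 * mWc d b₁' cA' mE' cDA'))) := by linarith only [h1, h3]
  exact mul_le_mul_of_nonneg_left h4 hBR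

/-! ## §2 The uniqueness socket's windows (`SP5u`): print's «c₂, c₃» and «largest possible α₄» with a source -/

/-- **THE 27 WINDOWS OF `B8SockSP5uProviderSrc.sp5uE_of_lettersUB_src` FROM ONE THRESHOLD, AT ONE RADIUS** — the sourced twin of
`B8SockP5uEWindows.uniqWindows_of_guard`: for `d, L ≥ 1`, `B₈ > 0` with `2 ≤ 5dLB₈`, `B₀′_H > 0`, `B₂′, B_G, B_R, γ ≥ 0` there are `α₄, c_u, c_P > 0` such that for
all `α₀, α₁ > 0` with `α₀ + α₁ ≤ c_P`, at `c⋆₈ = 5dLB₈(α₀ + α₁)`, `c_B = L·c⋆₈`, `c_{DA} = 2dL²c⋆₈` and the Sect. E sizes, the displayed family holds with the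
contraction windows (1.103)∕(1.106) read at `h_E₂ + γ(α₀ + α₁)∕2`.  Proof: `uniqWindows_of_guard` at the constant `2B₈ + γ`, then monotonicity.
[cite: Balaban1985RegularSpaces, Prop. 5 (1.109) p.94 («c₂, c₃»; «largest possible α₄ … independent of α₀ + α₁»), (1.103) p.93, (1.106) p.94, Thm 8 p.101] -/
theorem uniqWindows_of_guard_src (hd : 1 ≤ d) (hL : 1 ≤ L) {B₈ B₀'H B₂' BG BR γ : ℝ} (hB₈ : 0 < B₈) (hB : 2 ≤ 5 * (d : ℝ) * L * B₈)
    (hB₀'H : 0 < B₀'H) (hB₂' : 0 ≤ B₂') (hBG : 0 ≤ BG) (hBR : 0 ≤ BR) (hγ : 0 ≤ γ) :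
    ∃ α₄ cu cP : ℝ, 0 < α₄ ∧ 0 < cu ∧ 0 < cP ∧ ∀ α₀ α₁ : ℝ, 0 < α₀ → 0 < α₁ → α₀ + α₁ ≤ cP →
      ∀ cs cB cDA hE hE₂ lE lE₂ : ℝ, cs = 5 * (d : ℝ) * L * B₈ * (α₀ + α₁) → cB = L * cs → cDA = 2 * (d : ℝ) * (L : ℝ) ^ 2 * cs →
      hE = B₀'H * (C2p d * (40 * d * cB + α₄) * α₄) → hE₂ = B₂' * (C2p d * (40 * d * cB + α₄) * α₄) →
      lE = B₀'H * (4 * C2p d * (40 * d * cB + 2 * α₄)) → lE₂ = B₂' * (4 * C2p d * (40 * d * cB + 2 * α₄)) →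
      36 * d * B₈ * cs ≤ 1 / 2 ∧
      8 * (131072 * ((d : ℝ) + 1) ^ 2) * Real.exp (4 * (800 * ((d : ℝ) + 1) ^ 2 * ((d : ℝ) + 4)) * α₀) ≤ 16 * (131072 * ((d : ℝ) + 1) ^ 2) ∧
      2 * cs ^ 2 + 20 * d * α₀ * cs + 2 * (16 * (131072 * ((d : ℝ) + 1) ^ 2)) * cs ^ 2 ≤ α₀ + α₁ ∧
      (d : ℝ) * L * α₁ ≤ 1 / 8 ∧
      C0 d * α₀ ≤ 1 / 3 ∧ 4 * α₀ ≤ c2' d L ∧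
      Real.exp (4 * (800 * ((d : ℝ) + 1) ^ 2 * ((d : ℝ) + 4)) * α₀) * (1 + 8 * (131072 * ((d : ℝ) + 1) ^ 2) * cB) ≤ 2 ∧
      2 * cB ≤ c3 d L ∧ 2048 * (d : ℝ) * cB ≤ 1 ∧ 40 * d * cB ≤ 1 / 200 ∧
      200 * C6 d * (2 * α₄) ≤ 1 ∧ 12000 * ((d : ℝ) + 1) * L * (2 * α₄) ≤ 1 ∧
      C4G d L * (α₀ + 40 * d * cB + 4 * (2 * α₄)) ≤ 1 ∧
      1024 * ((d : ℝ) + 1) * ((d : ℝ) + 4) * L ^ 2 * α₀ ≤ 1 ∧ 32 * ((d : ℝ) + 1) ^ 2 * C6 d * L ^ 2 * α₀ ≤ 1 ∧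
      16 * d * C5' d * C6 d * (L : ℝ) ^ 2 * α₀ ≤ 1 ∧ 8 * d * C6 d * L * α₀ ≤ 1 ∧
      40 * d * cB + α₄ ≤ 1 / (4 * B₀'H * (2 * C2p d)) ∧ 2 * C6 d * (40 * d * cB + 4 * α₄) ≤ 1 / 8 ∧
      cB ≤ 1 / 13 ∧ α₄ / 4 + hE ≤ 1 / 24 ∧ α₄ / 4 + hE ≤ 1 / 140 ∧ 10 * (α₄ / 4 + hE) * BR ≤ 1 / 2 ∧
      BG * Mc d BR (α₄ / 4 + hE) cB (hE₂ + γ * (α₀ + α₁) / 2) cDA ≤ α₄ / 4 ∧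
      BG * Kc d BR (α₄ / 4 + hE) cB (hE₂ + γ * (α₀ + α₁) / 2) cDA lE₂ (1 + lE) (1 + lE) ≤ 1 / 2 ∧
      lE ≤ 1 / 2 ∧ cu + hE ≤ α₄ / 4 := by
  have hd' : (1 : ℝ) ≤ d := by exact_mod_cast hd
  have hL' : (1 : ℝ) ≤ L := by exact_mod_cast hL
  have hC2 : 0 < C2p d := C2p_pos
  have hC6 : (0 : ℝ) ≤ C6 d := le_trans (by norm_num) (two_le_C6' (d := d))
  have hC4 : 0 ≤ C4G d L := (C4G_pos' d L).le
  -- the un-sourced windows at the enlarged constant `2B₈ + γ`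
  have hBe : 0 < 2 * B₈ + γ := by positivity
  have hBle : B₈ ≤ 2 * B₈ + γ := by linarith only [hB₈, hγ]
  have hK : 5 * (d : ℝ) * L * B₈ ≤ 5 * (d : ℝ) * L * (2 * B₈ + γ) := mul_le_mul_of_nonneg_left hBle (by positivity)
  obtain ⟨α₄, cu, cP, hα₄, hcu, hcP, hw⟩ :=
    uniqWindows_of_guard hd hL hBe (hB.trans hK) hB₀'H hB₂' hBG hBR (zero_lt_one : (0 : ℝ) < 1)
  refine ⟨α₄, cu, cP, hα₄, hcu, hcP, ?_⟩
  intro α₀ α₁ hα₀ hα₁ hs cs cB cDA hE hE₂ lE lE₂ hcs hcB hcDA hhE hhE₂ hlE hlE₂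
  -- the enlarged scales
  obtain ⟨cs', hcs'⟩ : ∃ cs' : ℝ, cs' = 5 * (d : ℝ) * L * (2 * B₈ + γ) * (α₀ + α₁) := ⟨_, rfl⟩
  obtain ⟨cB', hcB'⟩ : ∃ cB' : ℝ, cB' = L * cs' := ⟨_, rfl⟩
  obtain ⟨cDA', hcDA'⟩ : ∃ cDA' : ℝ, cDA' = (d : ℝ) * (L : ℝ) ^ 2 * cs' := ⟨_, rfl⟩
  obtain ⟨hE', hhE'⟩ : ∃ hE' : ℝ, hE' = B₀'H * (C2p d * (40 * d * cB' + α₄) * α₄) := ⟨_, rfl⟩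
  obtain ⟨hE₂', hhE₂'⟩ : ∃ hE₂' : ℝ, hE₂' = B₂' * (C2p d * (40 * d * cB' + α₄) * α₄) := ⟨_, rfl⟩
  obtain ⟨lE', hlE'⟩ : ∃ lE' : ℝ, lE' = B₀'H * (4 * C2p d * (40 * d * cB' + 2 * α₄)) := ⟨_, rfl⟩
  obtain ⟨lE₂', hlE₂'⟩ : ∃ lE₂' : ℝ, lE₂' = B₂' * (4 * C2p d * (40 * d * cB' + 2 * α₄)) := ⟨_, rfl⟩
  obtain ⟨w1, w2, w3, w4, -, -, w7, w8, w9, w10, w11, w12, w13, w14, w15, w16, w17, w18, w19, w20, w21, w22, w23, w24, w25, w26, w27,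
    w28, w29⟩ := hw α₀ α₁ hα₀ hα₁ hs cs' cB' cDA' hE' hE₂' lE' lE₂' hcs' hcB' hcDA' hhE' hhE₂' hlE' hlE₂'
  -- comparisons
  have hs0 : 0 ≤ α₀ + α₁ := by positivity
  have ht0 : 0 ≤ γ * (α₀ + α₁) := by positivity
  have hcs0 : 0 ≤ cs := by rw [hcs]; positivity
  have hcsle : cs ≤ cs' := by rw [hcs, hcs']; exact mul_le_mul_of_nonneg_right hK hs0
  have hcB0 : 0 ≤ cB := by rw [hcB]; positivity
  have hcBle : cB ≤ cB' := by rw [hcB, hcB']; exact mul_le_mul_of_nonneg_left hcsle (by positivity)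
  have h40 : 40 * d * cB + α₄ ≤ 40 * d * cB' + α₄ := by
    have := mul_le_mul_of_nonneg_left hcBle (by positivity : (0 : ℝ) ≤ 40 * d); linarith only [this]
  have h40' : 40 * d * cB + 2 * α₄ ≤ 40 * d * cB' + 2 * α₄ := by linarith only [h40]
  have h400 : 0 ≤ 40 * d * cB + α₄ := by positivity
  have h400' : 0 ≤ 40 * d * cB + 2 * α₄ := by positivity
  have hEle : hE ≤ hE' := by
    rw [hhE, hhE']
    exact mul_le_mul_of_nonneg_left (mul_le_mul_of_nonneg_right (mul_le_mul_of_nonneg_left h40 hC2.le) hα₄.le) hB₀'H.le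
  have hE₂le : hE₂ ≤ hE₂' := by
    rw [hhE₂, hhE₂']
    exact mul_le_mul_of_nonneg_left (mul_le_mul_of_nonneg_right (mul_le_mul_of_nonneg_left h40 hC2.le) hα₄.le) hB₂'
  have hlEle : lE ≤ lE' := by
    rw [hlE, hlE']
    exact mul_le_mul_of_nonneg_left (mul_le_mul_of_nonneg_left h40' (by positivity)) hB₀'H.le
  have hlE₂le : lE₂ ≤ lE₂' := by
    rw [hlE₂, hlE₂']
    exact mul_le_mul_of_nonneg_left (mul_le_mul_of_nonneg_left h40' (by positivity)) hB₂'
  have hE0 : 0 ≤ hE := by rw [hhE]; positivity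
  have hE₂0 : 0 ≤ hE₂ := by rw [hhE₂]; positivity
  have hlE0 : 0 ≤ lE := by rw [hlE]; positivity
  have hcDA0 : 0 ≤ cDA := by rw [hcDA]; positivity
  have hb0 : 0 ≤ α₄ / 4 + hE := by positivity
  have hble : α₄ / 4 + hE ≤ α₄ / 4 + hE' := by linarith only [hEle]
  -- `c_{DA}′ = c_{DA} + 5d²L³γ(α₀ + α₁) ≥ c_{DA} + (5∕6)γ(α₀ + α₁)`
  have hDAle : cDA + 5 / 6 * (γ * (α₀ + α₁)) ≤ cDA' := by
    have e : cDA' = cDA + 5 * ((d : ℝ) ^ 2 * (L : ℝ) ^ 3) * (γ * (α₀ + α₁)) := by rw [hcDA', hcs', hcDA, hcs]; ring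
    have hdL : (1 : ℝ) ≤ (d : ℝ) ^ 2 * (L : ℝ) ^ 3 := one_le_mul_of_one_le_of_one_le (one_le_pow₀ hd') (one_le_pow₀ hL')
    have h := mul_le_mul_of_nonneg_right hdL ht0
    rw [e]; linarith only [h, ht0]
  refine ⟨?_, w2, ?_, w4, w7, w8, ?_, ?_, ?_, ?_, w13, w14, ?_, w16, w17, w18, w19, ?_, ?_, ?_, ?_, ?_, ?_, ?_, ?_, ?_, ?_⟩
  · -- 36dB₈c⋆₈ ≤ 36d(2B₈ + γ)c⋆′
    have h := mul_le_mul hBle hcsle hcs0 (hB₈.le.trans hBle)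
    have h' := mul_le_mul_of_nonneg_left h (by positivity : (0 : ℝ) ≤ 36 * d)
    have e1 : 36 * (d : ℝ) * B₈ * cs = 36 * d * (B₈ * cs) := by ring
    have e2 : 36 * (d : ℝ) * (2 * B₈ + γ) * cs' = 36 * d * ((2 * B₈ + γ) * cs') := by ring
    rw [e1]; rw [e2] at w1; exact h'.trans w1
  · -- (1.61) is monotone in c⋆
    have h1 : cs ^ 2 ≤ cs' ^ 2 := pow_le_pow_left₀ hcs0 hcsle 2
    have h2 : 20 * d * α₀ * cs ≤ 20 * d * α₀ * cs' := mul_le_mul_of_nonneg_left hcsle (by positivity)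
    have hC : (0 : ℝ) ≤ 2 * (16 * (131072 * ((d : ℝ) + 1) ^ 2)) := by positivity
    have h3 := mul_le_mul_of_nonneg_left h1 hC
    linarith only [h1, h2, h3, w3]
  · have hC : (0 : ℝ) ≤ 8 * (131072 * ((d : ℝ) + 1) ^ 2) := by positivity
    have h := mul_le_mul_of_nonneg_left hcBle hC
    exact (mul_le_mul_of_nonneg_left (by linarith only [h]) (Real.exp_pos _).le).trans w9
  · linarith only [hcBle, w10]
  · have := mul_le_mul_of_nonneg_left hcBle (by positivity : (0 : ℝ) ≤ 2048 * d); linarith only [this, w11]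
  · have := mul_le_mul_of_nonneg_left hcBle (by positivity : (0 : ℝ) ≤ 40 * d); linarith only [this, w12]
  · exact (mul_le_mul_of_nonneg_left (by linarith only [h40]) hC4).trans w15
  · exact h40.trans w20
  · exact (mul_le_mul_of_nonneg_left (by linarith only [h40]) (by positivity : (0 : ℝ) ≤ 2 * C6 d)).trans w21
  · exact hcBle.trans w22
  · linarith only [hEle, w23]
  · linarith only [hEle, w24]
  · exact (mul_le_mul_of_nonneg_right (mul_le_mul_of_nonneg_left hble (by norm_num)) hBR).trans w25
  · exact (mul_le_mul_of_nonneg_left (Mc_src_le (d := d) hBR hb0 hble hcB0 hcBle hE₂le hDAle) hBG).trans w26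
  · have hl1 : (0 : ℝ) ≤ 1 + lE := by positivity
    have hl2 : 1 + lE ≤ 1 + lE' := by linarith only [hlEle]
    exact (mul_le_mul_of_nonneg_left (Kc_src_le (d := d) hBR hb0 hble hcB0 hcBle hE₂0 hE₂le hcDA0 ht0 hDAle hlE₂le hl1 hl2) hBG).trans w27
  · exact hlEle.trans w28
  · linarith only [hEle, w29]

/-! ## §3 The existence sockets' windows (`SP5`, `SP5base`): Theorem 4's «there exists a constant c₁» with a source -/

/-- **THE WINDOWS OF `B8SockSP5ProviderSrc.sp5_of_sockLettersRD_src` ∕ `B8SockSP5BaseSrc.sp5base_of_sockLettersRD_src` FROM ONE THRESHOLD** — the sourced twin of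
`B8SockHFPWindows.hfpWindows_of_guard`: for `d, L ≥ 1`, `B₈, B₀′ > 0` with `2 ≤ 5dLB₈`, `B₀′_H > 0`, `B₂′, B_G, B_R, γ ≥ 0` and THE FREE-CONSTANT CONDITION WITH
SOURCE `3·(2dL²)·B_G·B_R·(B₈ + γ) ≤ B₀′·B₈`, there is `c_P > 0` such that for all `α₀, α₁ > 0` with `α₀ + α₁ ≤ c_P`, at `c⋆₈ = 5dLB₈(α₀ + α₁)`,
`α₄ = 8B₀′(5dLB₈)(α₀ + α₁)`, `c_B = L·c⋆₈`, `c_{DA} = 2dL²c⋆₈` and the Sect. E sizes: the 25 windows of `hfpWindows_of_guard` other than the two b9 thresholds,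
with (1.103)∕(1.106) read at `h_E₂ + γ(α₀ + α₁)∕2`, and the three adapter windows `α₄ ≤ 1∕84`, `c⋆₈ ≤ 1∕12`, `α₁ ≤ 1∕4`.  Proof: `hfpWindows_of_guard` at
`(B₀, B₀′) := (B₈ + γ, B₀′B₈∕(B₈ + γ))` (same `α₄`), then monotonicity; the adapter windows by three more minima.
[cite: Balaban1985RegularSpaces, Thm 4 p.88 («there exists a constant c₁»), (1.102)–(1.103) p.93, (1.106) p.94, (1.108) p.94, Thm 8 p.101] -/
theorem hfpWindows_of_guard_src (hd : 1 ≤ d) (hL : 1 ≤ L) {B₈ B₀' B₀'H B₂' BG BR γ : ℝ} (hB₈ : 0 < B₈) (hB₀' : 0 < B₀')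
    (hB : 2 ≤ 5 * (d : ℝ) * L * B₈) (hB₀'H : 0 < B₀'H) (hB₂' : 0 ≤ B₂') (hBG : 0 ≤ BG) (hBR : 0 ≤ BR) (hγ : 0 ≤ γ)
    (hfree : 3 * (2 * (d : ℝ) * (L : ℝ) ^ 2) * BG * BR * (B₈ + γ) ≤ B₀' * B₈) :
    ∃ cP : ℝ, 0 < cP ∧ ∀ α₀ α₁ : ℝ, 0 < α₀ → 0 < α₁ → α₀ + α₁ ≤ cP →
      ∀ cs α₄ cB cDA hE hE₂ lE lE₂ : ℝ, cs = 5 * (d : ℝ) * L * B₈ * (α₀ + α₁) → α₄ = 8 * B₀' * (5 * (d : ℝ) * L * B₈) * (α₀ + α₁) →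
      cB = L * cs → cDA = 2 * (d : ℝ) * (L : ℝ) ^ 2 * cs →
      hE = B₀'H * (C2p d * (40 * d * cB + α₄) * α₄) → hE₂ = B₂' * (C2p d * (40 * d * cB + α₄) * α₄) →
      lE = B₀'H * (4 * C2p d * (40 * d * cB + 2 * α₄)) → lE₂ = B₂' * (4 * C2p d * (40 * d * cB + 2 * α₄)) →
      36 * d * B₈ * cs ≤ 1 / 2 ∧
      8 * (131072 * ((d : ℝ) + 1) ^ 2) * Real.exp (4 * (800 * ((d : ℝ) + 1) ^ 2 * ((d : ℝ) + 4)) * α₀) ≤ 16 * (131072 * ((d : ℝ) + 1) ^ 2) ∧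
      2 * cs ^ 2 + 20 * d * α₀ * cs + 2 * (16 * (131072 * ((d : ℝ) + 1) ^ 2)) * cs ^ 2 ≤ α₀ + α₁ ∧
      (d : ℝ) * L * α₁ ≤ 1 / 8 ∧
      C0 d * α₀ ≤ 1 / 3 ∧ 4 * α₀ ≤ c2' d L ∧
      Real.exp (4 * (800 * ((d : ℝ) + 1) ^ 2 * ((d : ℝ) + 4)) * α₀) * (1 + 8 * (131072 * ((d : ℝ) + 1) ^ 2) * cB) ≤ 2 ∧
      2 * cB ≤ c3 d L ∧ 2048 * (d : ℝ) * cB ≤ 1 ∧ 40 * d * cB ≤ 1 / 200 ∧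
      200 * C6 d * (2 * α₄) ≤ 1 ∧ 12000 * ((d : ℝ) + 1) * L * (2 * α₄) ≤ 1 ∧
      C4G d L * (α₀ + 40 * d * cB + 4 * (2 * α₄)) ≤ 1 ∧
      1024 * ((d : ℝ) + 1) * ((d : ℝ) + 4) * L ^ 2 * α₀ ≤ 1 ∧ 32 * ((d : ℝ) + 1) ^ 2 * C6 d * L ^ 2 * α₀ ≤ 1 ∧
      16 * d * C5' d * C6 d * (L : ℝ) ^ 2 * α₀ ≤ 1 ∧ 8 * d * C6 d * L * α₀ ≤ 1 ∧
      40 * d * cB + α₄ ≤ 1 / (4 * B₀'H * (2 * C2p d)) ∧ 2 * C6 d * (40 * d * cB + 4 * α₄) ≤ 1 / 8 ∧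
      cB ≤ 1 / 13 ∧ α₄ / 4 + hE ≤ 1 / 24 ∧ α₄ / 4 + hE ≤ 1 / 140 ∧ 10 * (α₄ / 4 + hE) * BR ≤ 1 / 2 ∧
      BG * Mc d BR (α₄ / 4 + hE) cB (hE₂ + γ * (α₀ + α₁) / 2) cDA ≤ α₄ / 4 ∧
      BG * Kc d BR (α₄ / 4 + hE) cB (hE₂ + γ * (α₀ + α₁) / 2) cDA lE₂ (1 + lE) (1 + lE) ≤ 1 / 2 ∧
      α₄ ≤ 1 / 84 ∧ cs ≤ 1 / 12 ∧ α₁ ≤ 1 / 4 := by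
  have hd' : (1 : ℝ) ≤ d := by exact_mod_cast hd
  have hL' : (1 : ℝ) ≤ L := by exact_mod_cast hL
  have hC2 : 0 < C2p d := C2p_pos
  have hC6 : (0 : ℝ) ≤ C6 d := le_trans (by norm_num) (two_le_C6' (d := d))
  have hC4 : 0 ≤ C4G d L := (C4G_pos' d L).le
  -- the un-sourced windows at `(B₀, B₀′) := (B₈ + γ, B₀′B₈∕(B₈ + γ))`
  have hBe : 0 < B₈ + γ := by positivity
  have hBle : B₈ ≤ B₈ + γ := by linarith only [hγ]
  have hK : 5 * (d : ℝ) * L * B₈ ≤ 5 * (d : ℝ) * L * (B₈ + γ) := mul_le_mul_of_nonneg_left hBle (by positivity)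
  have hB₀'e : 0 < B₀' * B₈ / (B₈ + γ) := by positivity
  have hfree' : 3 * (2 * (d : ℝ) * (L : ℝ) ^ 2) * BG * BR ≤ B₀' * B₈ / (B₈ + γ) := by rw [le_div_iff₀ hBe]; exact hfree
  obtain ⟨cP, hcP, hw⟩ := hfpWindows_of_guard hd hL hBe hB₀'e (hB.trans hK) hB₀'H hB₂' hBG hBR (zero_lt_one : (0 : ℝ) < 1) hfree'
  -- the three adapter thresholds
  have hK₈ : 0 < 5 * (d : ℝ) * L * B₈ := by positivity
  refine ⟨min cP (min (1 / (84 * (8 * B₀' * (5 * (d : ℝ) * L * B₈)))) (min (1 / (12 * (5 * (d : ℝ) * L * B₈))) (1 / 4))),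
    lt_min hcP (lt_min (by positivity) (lt_min (by positivity) (by norm_num))), ?_⟩
  intro α₀ α₁ hα₀ hα₁ hs cs α₄ cB cDA hE hE₂ lE lE₂ hcs hα₄ hcB hcDA hhE hhE₂ hlE hlE₂
  have hs1 : α₀ + α₁ ≤ cP := hs.trans (min_le_left _ _)
  have hs2 : α₀ + α₁ ≤ 1 / (84 * (8 * B₀' * (5 * (d : ℝ) * L * B₈))) := hs.trans ((min_le_right _ _).trans (min_le_left _ _))
  have hs3 : α₀ + α₁ ≤ 1 / (12 * (5 * (d : ℝ) * L * B₈)) :=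
    hs.trans ((min_le_right _ _).trans ((min_le_right _ _).trans (min_le_left _ _)))
  have hs4 : α₀ + α₁ ≤ 1 / 4 := hs.trans ((min_le_right _ _).trans ((min_le_right _ _).trans (min_le_right _ _)))
  -- the enlarged scales (same `α₄`)
  obtain ⟨cs', hcs'⟩ : ∃ cs' : ℝ, cs' = 5 * (d : ℝ) * L * (B₈ + γ) * (α₀ + α₁) := ⟨_, rfl⟩
  obtain ⟨cB', hcB'⟩ : ∃ cB' : ℝ, cB' = L * cs' := ⟨_, rfl⟩
  obtain ⟨cDA', hcDA'⟩ : ∃ cDA' : ℝ, cDA' = 2 * (d : ℝ) * (L : ℝ) ^ 2 * cs' := ⟨_, rfl⟩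
  obtain ⟨hE', hhE'⟩ : ∃ hE' : ℝ, hE' = B₀'H * (C2p d * (40 * d * cB' + α₄) * α₄) := ⟨_, rfl⟩
  obtain ⟨hE₂', hhE₂'⟩ : ∃ hE₂' : ℝ, hE₂' = B₂' * (C2p d * (40 * d * cB' + α₄) * α₄) := ⟨_, rfl⟩
  obtain ⟨lE', hlE'⟩ : ∃ lE' : ℝ, lE' = B₀'H * (4 * C2p d * (40 * d * cB' + 2 * α₄)) := ⟨_, rfl⟩
  obtain ⟨lE₂', hlE₂'⟩ : ∃ lE₂' : ℝ, lE₂' = B₂' * (4 * C2p d * (40 * d * cB' + 2 * α₄)) := ⟨_, rfl⟩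
  have hα₄' : α₄ = 8 * (B₀' * B₈ / (B₈ + γ)) * (5 * (d : ℝ) * L * (B₈ + γ)) * (α₀ + α₁) := by
    rw [hα₄]; field_simp
  obtain ⟨w1, w2, w3, w4, -, -, w7, w8, w9, w10, w11, w12, w13, w14, w15, w16, w17, w18, w19, w20, w21, w22, w23, w24, w25, w26, w27⟩ :=
    hw α₀ α₁ hα₀ hα₁ hs1 cs' α₄ cB' cDA' hE' hE₂' lE' lE₂' hcs' hα₄' hcB' hcDA' hhE' hhE₂' hlE' hlE₂'
  -- comparisons
  have hs0 : 0 ≤ α₀ + α₁ := by positivity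
  have ht0 : 0 ≤ γ * (α₀ + α₁) := by positivity
  have hα₄0 : 0 < α₄ := by rw [hα₄]; positivity
  have hcs0 : 0 ≤ cs := by rw [hcs]; positivity
  have hcsle : cs ≤ cs' := by rw [hcs, hcs']; exact mul_le_mul_of_nonneg_right hK hs0
  have hcB0 : 0 ≤ cB := by rw [hcB]; positivity
  have hcBle : cB ≤ cB' := by rw [hcB, hcB']; exact mul_le_mul_of_nonneg_left hcsle (by positivity)
  have h40 : 40 * d * cB + α₄ ≤ 40 * d * cB' + α₄ := by
    have := mul_le_mul_of_nonneg_left hcBle (by positivity : (0 : ℝ) ≤ 40 * d); linarith only [this]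
  have h40' : 40 * d * cB + 2 * α₄ ≤ 40 * d * cB' + 2 * α₄ := by linarith only [h40]
  have h400 : 0 ≤ 40 * d * cB + α₄ := by positivity
  have h400' : 0 ≤ 40 * d * cB + 2 * α₄ := by positivity
  have hEle : hE ≤ hE' := by
    rw [hhE, hhE']
    exact mul_le_mul_of_nonneg_left (mul_le_mul_of_nonneg_right (mul_le_mul_of_nonneg_left h40 hC2.le) hα₄0.le) hB₀'H.le
  have hE₂le : hE₂ ≤ hE₂' := by
    rw [hhE₂, hhE₂']
    exact mul_le_mul_of_nonneg_left (mul_le_mul_of_nonneg_right (mul_le_mul_of_nonneg_left h40 hC2.le) hα₄0.le) hB₂'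
  have hlEle : lE ≤ lE' := by
    rw [hlE, hlE']
    exact mul_le_mul_of_nonneg_left (mul_le_mul_of_nonneg_left h40' (by positivity)) hB₀'H.le
  have hlE₂le : lE₂ ≤ lE₂' := by
    rw [hlE₂, hlE₂']
    exact mul_le_mul_of_nonneg_left (mul_le_mul_of_nonneg_left h40' (by positivity)) hB₂'
  have hE0 : 0 ≤ hE := by rw [hhE]; positivity
  have hE₂0 : 0 ≤ hE₂ := by rw [hhE₂]; positivity
  have hlE0 : 0 ≤ lE := by rw [hlE]; positivity
  have hcDA0 : 0 ≤ cDA := by rw [hcDA]; positivity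
  have hb0 : 0 ≤ α₄ / 4 + hE := by positivity
  have hble : α₄ / 4 + hE ≤ α₄ / 4 + hE' := by linarith only [hEle]
  -- `c_{DA}′ = c_{DA} + 10d²L³γ(α₀ + α₁) ≥ c_{DA} + (5∕6)γ(α₀ + α₁)`
  have hDAle : cDA + 5 / 6 * (γ * (α₀ + α₁)) ≤ cDA' := by
    have e : cDA' = cDA + 10 * ((d : ℝ) ^ 2 * (L : ℝ) ^ 3) * (γ * (α₀ + α₁)) := by rw [hcDA', hcs', hcDA, hcs]; ring
    have hdL : (1 : ℝ) ≤ (d : ℝ) ^ 2 * (L : ℝ) ^ 3 := one_le_mul_of_one_le_of_one_le (one_le_pow₀ hd') (one_le_pow₀ hL')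
    have h := mul_le_mul_of_nonneg_right hdL ht0
    rw [e]; linarith only [h, ht0]
  refine ⟨?_, w2, ?_, w4, w7, w8, ?_, ?_, ?_, ?_, w13, w14, ?_, w16, w17, w18, w19, ?_, ?_, ?_, ?_, ?_, ?_, ?_, ?_, ?_, ?_, ?_⟩
  · have h := mul_le_mul hBle hcsle hcs0 (hB₈.le.trans hBle)
    have h' := mul_le_mul_of_nonneg_left h (by positivity : (0 : ℝ) ≤ 36 * d)
    have e1 : 36 * (d : ℝ) * B₈ * cs = 36 * d * (B₈ * cs) := by ring
    have e2 : 36 * (d : ℝ) * (B₈ + γ) * cs' = 36 * d * ((B₈ + γ) * cs') := by ring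
    rw [e1]; rw [e2] at w1; exact h'.trans w1
  · have h1 : cs ^ 2 ≤ cs' ^ 2 := pow_le_pow_left₀ hcs0 hcsle 2
    have h2 : 20 * d * α₀ * cs ≤ 20 * d * α₀ * cs' := mul_le_mul_of_nonneg_left hcsle (by positivity)
    have hC : (0 : ℝ) ≤ 2 * (16 * (131072 * ((d : ℝ) + 1) ^ 2)) := by positivity
    have h3 := mul_le_mul_of_nonneg_left h1 hC
    linarith only [h1, h2, h3, w3]
  · have hC : (0 : ℝ) ≤ 8 * (131072 * ((d : ℝ) + 1) ^ 2) := by positivity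
    have h := mul_le_mul_of_nonneg_left hcBle hC
    exact (mul_le_mul_of_nonneg_left (by linarith only [h]) (Real.exp_pos _).le).trans w9
  · linarith only [hcBle, w10]
  · have := mul_le_mul_of_nonneg_left hcBle (by positivity : (0 : ℝ) ≤ 2048 * d); linarith only [this, w11]
  · have := mul_le_mul_of_nonneg_left hcBle (by positivity : (0 : ℝ) ≤ 40 * d); linarith only [this, w12]
  · exact (mul_le_mul_of_nonneg_left (by linarith only [h40]) hC4).trans w15
  · exact h40.trans w20
  · exact (mul_le_mul_of_nonneg_left (by linarith only [h40]) (by positivity : (0 : ℝ) ≤ 2 * C6 d)).trans w21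
  · exact hcBle.trans w22
  · linarith only [hEle, w23]
  · linarith only [hEle, w24]
  · exact (mul_le_mul_of_nonneg_right (mul_le_mul_of_nonneg_left hble (by norm_num)) hBR).trans w25
  · exact (mul_le_mul_of_nonneg_left (Mc_src_le (d := d) hBR hb0 hble hcB0 hcBle hE₂le hDAle) hBG).trans w26
  · have hl1 : (0 : ℝ) ≤ 1 + lE := by positivity
    have hl2 : 1 + lE ≤ 1 + lE' := by linarith only [hlEle]
    exact (mul_le_mul_of_nonneg_left (Kc_src_le (d := d) hBR hb0 hble hcB0 hcBle hE₂0 hE₂le hcDA0 ht0 hDAle hlE₂le hl1 hl2) hBG).trans w27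
  · -- `α₄ = 8B₀′(5dLB₈)(α₀ + α₁) ≤ 1∕84`
    have hpos : 0 < 84 * (8 * B₀' * (5 * (d : ℝ) * L * B₈)) := by positivity
    have h := (le_div_iff₀ hpos).1 hs2
    rw [hα₄]
    have e : 8 * B₀' * (5 * (d : ℝ) * L * B₈) * (α₀ + α₁) = (α₀ + α₁) * (84 * (8 * B₀' * (5 * (d : ℝ) * L * B₈))) / 84 := by ring
    rw [e]; linarith only [h]
  · -- `c⋆₈ ≤ 1∕12`
    have hpos : 0 < 12 * (5 * (d : ℝ) * L * B₈) := by positivity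
    have h := (le_div_iff₀ hpos).1 hs3
    rw [hcs]
    have e : 5 * (d : ℝ) * L * B₈ * (α₀ + α₁) = (α₀ + α₁) * (12 * (5 * (d : ℝ) * L * B₈)) / 12 := by ring
    rw [e]; linarith only [h]
  · linarith only [hs4, hα₀]

end Literature.MathematicalPhysics.QuantumFieldTheory.Balaban1983to89.B8SockWindowsSrc

end
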